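import Summits.Ventures.PercRepro2.CaseOneDegenerate

/-!
# `a₃` pendant at a mark: `(ii)`, `(i)`, `(J1₁)` on both sides
(blind cell PercRepro2, p1 g17; S5 (S5.a″) (n) (6): K8 + the coincident markings)

By the pendant reduction K8 (`zSplitII_of_leaf_at`, `zSplitI_of_leaf_at`) a leaf `a₃` at `v` is closed
on a side as soon as the PD form AND the Q form of that side hold at `v` (with `v` as the statement
vertex, in the same graph). When `v` is a MARK both are theorems of `CaseOneDegenerate.lean`, so
**`a₃` pendant at `o`, at `b`, at `a₁` or at `a₂` satisfies `(ii)`, `(i)` and `(J1₁)` for every finite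
graph and every weight vector** (`zSplitII_of_leaf_at_o`, `zSplitI_of_leaf_at_o`,
`jOneOne_of_leaf_at_o`, and the `_b`, `_a1`, `_a2` versions). The `(ii)`-side at `o` / `b` and both sides
at a root were known (`zSplitII_of_rootsAndO/B` with no root edges, K7 / K7′); the `(i)`-side at `o` and
at `b` is new. Own code; standard axioms. -/

namespace Summit.Ventures.PercRepro2

namespace CaseOne

section PendantMark
variable {V : Type*} {E : Type*} [Fintype E] [DecidableEq E] [Fintype V] [DecidableEq V]
  {R : Type*} [Field R] [LinearOrder R] [IsStrictOrderedRing R]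
variable {ends : E → Sym2 V} {a₃ : V} {e₀ : E}

/-- **`(ii)` for `a₃` pendant at `o`.** -/
theorem zSplitII_of_leaf_at_o (p : E → R) (hp : IsProbVec p) {o : V} (hl : IsLeafAt ends o a₃ e₀)
    (a₁ a₂ b : V) (h1 : a₁ ≠ a₃) (h2 : a₂ ≠ a₃) (hb : b ≠ a₃) : ZSplitII p ends o a₁ a₂ a₃ b :=
  zSplitII_of_leaf_at p hp hl o a₁ a₂ b hl.ne h1 h2 hb (zSplitII_of_o_eq_a3 p hp a₁ a₂ o b)
    (zSplitIIQ_of_o_eq_a3 p hp a₁ a₂ o b)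

/-- **`(i)` for `a₃` pendant at `o`.** -/
theorem zSplitI_of_leaf_at_o (p : E → R) (hp : IsProbVec p) {o : V} (hl : IsLeafAt ends o a₃ e₀)
    (a₁ a₂ b : V) (h1 : a₁ ≠ a₃) (h2 : a₂ ≠ a₃) (hb : b ≠ a₃) : ZSplitI p ends o a₁ a₂ a₃ b :=
  zSplitI_of_leaf_at p hp hl o a₁ a₂ b hl.ne h1 h2 hb (zSplitI_of_o_eq_a3 p hp a₁ a₂ o b)
    (zSplitIQ_of_o_eq_a3 p hp a₁ a₂ o b)

/-- **`(J1₁)` for `a₃` pendant at `o`.** -/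
theorem jOneOne_of_leaf_at_o (p : E → R) (hp : IsProbVec p) {o : V} (hl : IsLeafAt ends o a₃ e₀)
    (a₁ a₂ b : V) (h1 : a₁ ≠ a₃) (h2 : a₂ ≠ a₃) (hb : b ≠ a₃) : JOneOne p ends o a₁ a₂ a₃ b :=
  jOneOne_of_i_of_ii p ends o a₁ a₂ a₃ b (zSplitI_of_leaf_at_o p hp hl a₁ a₂ b h1 h2 hb)
    (zSplitII_of_leaf_at_o p hp hl a₁ a₂ b h1 h2 hb)

/-- **`(ii)` for `a₃` pendant at `b`.** -/
theorem zSplitII_of_leaf_at_b (p : E → R) (hp : IsProbVec p) {b : V} (hl : IsLeafAt ends b a₃ e₀)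
    (o a₁ a₂ : V) (ho : o ≠ a₃) (h1 : a₁ ≠ a₃) (h2 : a₂ ≠ a₃) : ZSplitII p ends o a₁ a₂ a₃ b :=
  zSplitII_of_leaf_at p hp hl o a₁ a₂ b ho h1 h2 hl.ne (zSplitII_of_b_eq_a3 p hp o a₁ a₂ b)
    (zSplitIIQ_of_b_eq_a3 p hp o a₁ a₂ b)

/-- **`(i)` for `a₃` pendant at `b`.** -/
theorem zSplitI_of_leaf_at_b (p : E → R) (hp : IsProbVec p) {b : V} (hl : IsLeafAt ends b a₃ e₀)
    (o a₁ a₂ : V) (ho : o ≠ a₃) (h1 : a₁ ≠ a₃) (h2 : a₂ ≠ a₃) : ZSplitI p ends o a₁ a₂ a₃ b :=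
  zSplitI_of_leaf_at p hp hl o a₁ a₂ b ho h1 h2 hl.ne (zSplitI_of_b_eq_a3 p hp o a₁ a₂ b)
    (zSplitIQ_of_b_eq_a3 p hp o a₁ a₂ b)

/-- **`(J1₁)` for `a₃` pendant at `b`.** -/
theorem jOneOne_of_leaf_at_b (p : E → R) (hp : IsProbVec p) {b : V} (hl : IsLeafAt ends b a₃ e₀)
    (o a₁ a₂ : V) (ho : o ≠ a₃) (h1 : a₁ ≠ a₃) (h2 : a₂ ≠ a₃) : JOneOne p ends o a₁ a₂ a₃ b :=
  jOneOne_of_i_of_ii p ends o a₁ a₂ a₃ b (zSplitI_of_leaf_at_b p hp hl o a₁ a₂ ho h1 h2)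
    (zSplitII_of_leaf_at_b p hp hl o a₁ a₂ ho h1 h2)

/-- **`(ii)` for `a₃` pendant at `a₁`** (K7, re-derived). -/
theorem zSplitII_of_leaf_at_a1 (p : E → R) (hp : IsProbVec p) {a₁ : V} (hl : IsLeafAt ends a₁ a₃ e₀)
    (o a₂ b : V) (ho : o ≠ a₃) (h2 : a₂ ≠ a₃) (hb : b ≠ a₃) : ZSplitII p ends o a₁ a₂ a₃ b :=
  zSplitII_of_leaf_at p hp hl o a₁ a₂ b ho hl.ne h2 hb (zSplitII_of_a1_eq_a3 p hp o a₁ a₂ b)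
    (zSplitIIQ_of_a1_eq_a3 p hp o a₁ a₂ b)

/-- **`(i)` for `a₃` pendant at `a₁`** (K7, re-derived). -/
theorem zSplitI_of_leaf_at_a1 (p : E → R) (hp : IsProbVec p) {a₁ : V} (hl : IsLeafAt ends a₁ a₃ e₀)
    (o a₂ b : V) (ho : o ≠ a₃) (h2 : a₂ ≠ a₃) (hb : b ≠ a₃) : ZSplitI p ends o a₁ a₂ a₃ b :=
  zSplitI_of_leaf_at p hp hl o a₁ a₂ b ho hl.ne h2 hb (zSplitI_of_a1_eq_a3 p hp o a₁ a₂ b)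
    (zSplitIQ_of_a1_eq_a3 p hp o a₁ a₂ b)

omit [Fintype V] [DecidableEq V] in
/-- **`(ii)` for `a₃` pendant at `a₂`.** -/
theorem zSplitII_of_leaf_at_a2 (p : E → R) (hp : IsProbVec p) {a₂ : V} (hl : IsLeafAt ends a₂ a₃ e₀)
    (o a₁ b : V) (ho : o ≠ a₃) (h1 : a₁ ≠ a₃) (hb : b ≠ a₃) : ZSplitII p ends o a₁ a₂ a₃ b :=
  zSplitII_of_leaf_at p hp hl o a₁ a₂ b ho h1 hl.ne hb (zSplitII_of_a2_eq_a3 p o a₁ a₂ b)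
    (zSplitIIQ_of_a2_eq_a3 p o a₁ a₂ b)

omit [Fintype V] [DecidableEq V] in
/-- **`(i)` for `a₃` pendant at `a₂`.** -/
theorem zSplitI_of_leaf_at_a2 (p : E → R) (hp : IsProbVec p) {a₂ : V} (hl : IsLeafAt ends a₂ a₃ e₀)
    (o a₁ b : V) (ho : o ≠ a₃) (h1 : a₁ ≠ a₃) (hb : b ≠ a₃) : ZSplitI p ends o a₁ a₂ a₃ b :=
  zSplitI_of_leaf_at p hp hl o a₁ a₂ b ho h1 hl.ne hb (zSplitI_of_a2_eq_a3 p o a₁ a₂ b)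
    (zSplitIQ_of_a2_eq_a3 p o a₁ a₂ b)

/-- **`(J1₁)` for `a₃` pendant at a root.** -/
theorem jOneOne_of_leaf_at_a1 (p : E → R) (hp : IsProbVec p) {a₁ : V} (hl : IsLeafAt ends a₁ a₃ e₀)
    (o a₂ b : V) (ho : o ≠ a₃) (h2 : a₂ ≠ a₃) (hb : b ≠ a₃) : JOneOne p ends o a₁ a₂ a₃ b :=
  jOneOne_of_i_of_ii p ends o a₁ a₂ a₃ b (zSplitI_of_leaf_at_a1 p hp hl o a₂ b ho h2 hb)
    (zSplitII_of_leaf_at_a1 p hp hl o a₂ b ho h2 hb)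

omit [Fintype V] [DecidableEq V] in
/-- **`(J1₁)` for `a₃` pendant at the root `a₂`.** -/
theorem jOneOne_of_leaf_at_a2 (p : E → R) (hp : IsProbVec p) {a₂ : V} (hl : IsLeafAt ends a₂ a₃ e₀)
    (o a₁ b : V) (ho : o ≠ a₃) (h1 : a₁ ≠ a₃) (hb : b ≠ a₃) : JOneOne p ends o a₁ a₂ a₃ b :=
  jOneOne_of_i_of_ii p ends o a₁ a₂ a₃ b (zSplitI_of_leaf_at_a2 p hp hl o a₁ b ho h1 hb)
    (zSplitII_of_leaf_at_a2 p hp hl o a₁ b ho h1 hb)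

end PendantMark

end CaseOne

end Summit.Ventures.PercRepro2
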